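import Literature.NumberTheory.Sieve.SmoothLargeValuesDilate
import HarnessLib

/-!
# Large values of exponential sums over smooth numbers, IIIb: differences off the "fairly major" arcs

Topic `Literature/NumberTheory/Sieve`; a PROVED file toward
`Literature.NumberTheory.DiophantineGeometry.XYZUpperHalf` ([Harper2016, Cor. 1]). The last part
of the proof of Proposition 3 of op. cit. (§4, pp. 16–17), assembled from
`sum_geomBound_prefix_le` (Erdős–Turán for one difference), `norm_smoothExpSum_dilate_le` (the
dilated sums, via Theorem 1 at the scale `X'` or the crude bound) and Smooth Numbers Result 2:
if `t` is NOT "fairly major", i.e. there is no `q ≤ Q⋆` and `a` with `|t − a/q| ≤ Q⋆ yK/(qx)`, then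

`sum_geomBound_prefix_le_of_not_major`:
`∑_{m ∈ 𝓜} min(x/m, 1/(2‖mt‖)) ≤ C (log x)⁴ (yK)^{1−α} y^{(5/2)(1−α)} (K^{1/2−α} + √K · Q⋆^{−1/2+(3/2)(1−α)}) 𝓟 + x^{19/20}`,
`𝓜 = prefixSet y (x/(yK))`, `𝓟 = x^α ζ(α,y)/√φ₂(α,y)`, `α = α(x,y)` (printed: `≪ Ψ(x,y)/K^{2/5}`-type
bounds when `q ≥ K log¹² x` or `|η| ≥ K² y log¹² x/x`; our thresholds differ because we use the
Fejér-kernel form of Erdős–Turán, with `H = 16K` frequencies).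

## References

* A. J. Harper, Compositio Math. 152 (2016) 1121–1158, §4, proof of Proposition 3 [Harper2016].
-/

noncomputable section

open Finset Real
open scoped FourierTransform
open Literature.NumberTheory.Sieve.Vinogradov

namespace Literature.NumberTheory.Sieve

/-- `smoothBlock y U ⊆ S(y) ∩ [1, 2U]` as a difference: the sum over the block is the difference of
the sums over `smoothNumbersUpTo (2U-1)` and `smoothNumbersUpTo (U-1)`. [folklore] -/
theorem sum_smoothBlock_eq_sub {M : Type*} [AddCommGroup M] {y U : ℕ} (hU : 1 ≤ U) (f : ℕ → M) :
    ∑ m ∈ smoothBlock y U, f m =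
      ∑ m ∈ Nat.smoothNumbersUpTo (2 * U - 1) (y + 1), f m - ∑ m ∈ Nat.smoothNumbersUpTo (U - 1) (y + 1), f m := by
  classical
  have hsub : Nat.smoothNumbersUpTo (U - 1) (y + 1) ⊆ Nat.smoothNumbersUpTo (2 * U - 1) (y + 1) := by
    intro m hm
    rw [Nat.mem_smoothNumbersUpTo] at hm ⊢
    exact ⟨by omega, hm.2⟩
  have hsd : smoothBlock y U = Nat.smoothNumbersUpTo (2 * U - 1) (y + 1) \ Nat.smoothNumbersUpTo (U - 1) (y + 1) := by
    ext m
    rw [mem_smoothBlock, Finset.mem_sdiff, Nat.mem_smoothNumbersUpTo, Nat.mem_smoothNumbersUpTo]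
    constructor
    · rintro ⟨h1, h2, h3⟩; exact ⟨⟨by omega, h3⟩, fun h => by omega⟩
    · rintro ⟨⟨h1, h2⟩, h3⟩
      refine ⟨?_, by omega, h2⟩
      by_contra h; push Not at h; exact h3 ⟨by omega, h2⟩
  rw [hsd, Finset.sum_sdiff_eq_sub hsub]

set_option maxHeartbeats 6000000 in
-- long
/-- **One dyadic class** in `sum_geomBound_prefix_le`, bounded via `norm_smoothExpSum_dilate_le`
and Smooth Numbers Result 2: for `W = x/(yK) < U ≤ 2x/K`, `η = 1/(2√K)`, `H = 16K`,
`t = a/q + η₀` as in `norm_smoothExpSum_dilate_le`: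
`x U⁻¹ (5η N_U + ∑_{0<|d|≤H} |∑_{m ∈ s_U} e(dmt)|/|d|)
   ≤ (10 C₂ K^{-1/2} + 64 C √K (log x)³ y^{(5/2)(1−α)} (q(1+|η₀|W))^e) (yK)^{1−α} 𝓟 + 6400 y K² (1+log x)² y² x^{4/5}`.
[cite: Harper2016, §4, proof of Proposition 3] -/
theorem nonmajor_class_bound :
    ∃ C C₂ x₀ : ℝ, 0 < C ∧ 0 < C₂ ∧ ∀ (x : ℝ) (y : ℕ), x₀ ≤ x → Real.log x ^ 8 ≤ y →
      Real.log y ≤ 1 / 2 * Real.log x ^ (1 / 6 : ℝ) → (y : ℝ) ^ 200 ≤ x →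
      ∀ (K : ℕ), 16 ≤ K → (K : ℝ) ^ 1000 ≤ x →
      ∀ (q : ℕ), 1 ≤ q → (q : ℝ) ≤ x ^ (3 / 5 : ℝ) → ∀ (a : ℤ), IsCoprime a (q : ℤ) →
      ∀ (η₀ : ℝ), |η₀| * q * x ^ (3 / 5 : ℝ) ≤ 1 →
      ∀ (U : ℕ), x / (y * K) < U → (U : ℝ) ≤ 2 * x / K →
        x * (1 / (U : ℝ)) *
          (5 * (1 / (2 * Real.sqrt K)) * (smoothBlock y U).card +
            ∑ d ∈ (Finset.Icc (-((16 * K : ℕ) : ℤ)) (16 * K : ℕ)).erase 0,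
              ‖∑ m ∈ smoothBlock y U, (𝐞 ((d : ℝ) * ((m : ℝ) * ((a : ℝ) / q + η₀))) : ℂ)‖ / |(d : ℝ)|) ≤
          (10 * C₂ * (K : ℝ) ^ (-(1 / 2 : ℝ)) +
              64 * C * Real.sqrt K * Real.log x ^ 3 * (y : ℝ) ^ (5 / 2 * (1 - saddlePoint x y)) *
                ((q : ℝ) * (1 + |η₀| * (x / (y * K)))) ^ (-(1 / 2 : ℝ) + 3 / 2 * (1 - saddlePoint x y))) *
            (((y : ℝ) * K) ^ (1 - saddlePoint x y) *
              (x ^ saddlePoint x y *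
                (smoothZeta (saddlePoint x y) y / Real.sqrt (saddlePhi₂ (saddlePoint x y) y)))) +
          6400 * y * (K : ℝ) ^ 2 * ((1 + Real.log x) ^ 2 * (y : ℝ) ^ 2 * x ^ (4 / 5 : ℝ)) := by
  classical
  obtain ⟨C, x₀d, hC, hD⟩ := norm_smoothExpSum_dilate_le
  obtain ⟨C₂, x₀M, hC₂, hM⟩ := card_smoothNumbersUpTo_le_model_of_le
  obtain ⟨x₀1, hlt1⟩ := saddlePoint_lt_one
  refine ⟨C, C₂, max (max x₀d x₀M) (max x₀1 (Real.exp 400)), hC, hC₂,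
    fun x y hx hy8 hy6 hy200 K hK16 hK1000 q hq1 hqx a hcop η₀ hη₀ U hUlo hUhi => ?_⟩
  have hx₀d : x₀d ≤ x := le_trans ((le_max_left _ _).trans (le_max_left _ _)) hx
  have hx₀M : x₀M ≤ x := le_trans ((le_max_right _ _).trans (le_max_left _ _)) hx
  have hx₀1 : x₀1 ≤ x := le_trans ((le_max_left _ _).trans (le_max_right _ _)) hx
  have hxe : Real.exp 400 ≤ x := le_trans ((le_max_right _ _).trans (le_max_right _ _)) hx
  have hK16r : (16 : ℝ) ≤ K := by exact_mod_cast hK16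
  ------------------------------------------------------------------
  set Lx := Real.log x with hLx
  have hLx400 : 400 ≤ Lx := by
    have := Real.log_le_log (Real.exp_pos _) hxe; rwa [Real.log_exp] at this
  have hx1 : 1 < x := by
    have : (1 : ℝ) < Real.exp 400 := by have := Real.add_one_le_exp (400 : ℝ); linarith
    exact lt_of_lt_of_le this hxe
  have hx0 : 0 < x := by linarith
  have hLx1 : 1 ≤ Lx := by linarith
  have hy4 : Lx ^ 4 ≤ y := le_trans (pow_le_pow_right₀ hLx1 (by norm_num)) hy8
  have hyL : Lx ≤ y := by
    calc Lx = Lx ^ 1 := (pow_one _).symm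
      _ ≤ Lx ^ 8 := pow_le_pow_right₀ hLx1 (by norm_num)
      _ ≤ y := hy8
  have hy1 : (1 : ℝ) ≤ y := by linarith
  have hy0 : (0 : ℝ) < y := by linarith
  have hy2 : 2 ≤ y := by exact_mod_cast (show (2 : ℝ) ≤ y by linarith)
  have hy6' : Real.log y ≤ Real.log x ^ (1 / 6 : ℝ) := by
    refine hy6.trans ?_
    have : 0 ≤ Lx ^ (1 / 6 : ℝ) := by positivity
    rw [hLx] at this ⊢; linarith
  have hlogy : Real.log y ≤ Lx := by
    refine hy6'.trans ?_
    calc Real.log x ^ (1 / 6 : ℝ) ≤ Real.log x ^ (1 : ℝ) := Real.rpow_le_rpow_of_exponent_le hLx1 (by norm_num)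
      _ = Lx := by rw [Real.rpow_one]
  have hyx : (y : ℝ) ≤ x := by
    rw [← Real.exp_log hy0, ← Real.exp_log hx0]; exact Real.exp_le_exp.mpr hlogy
  have hK0 : (0 : ℝ) < K := by linarith
  have hsqK0 : 0 < Real.sqrt K := Real.sqrt_pos.mpr hK0
  set α := saddlePoint x y with hαdef
  have hα0 : 0 < α := by rw [hαdef]; exact saddlePoint_pos hx1 hy2
  have hα1 : α ≤ 1 := by
    have hy3 : Real.log x ^ 3 ≤ y := le_trans (pow_le_pow_right₀ hLx1 (by norm_num)) hy8
    exact (hlt1 x y hx₀1 hy3 hyx hy6').le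
  set e : ℝ := -(1 / 2 : ℝ) + 3 / 2 * (1 - α) with he
  set ζt := smoothZeta α y / Real.sqrt (saddlePhi₂ α y) with hζt
  have hζt0 : 0 ≤ ζt := div_nonneg (smoothZeta_pos hα0).le (Real.sqrt_nonneg _)
  set 𝓟 := x ^ α * ζt with h𝓟
  have h𝓟0 : 0 ≤ 𝓟 := by positivity
  set W := x / (y * K) with hW
  have hyK0 : (0 : ℝ) < y * K := by positivity
  have hW0 : 0 < W := by positivity
  have hU0 : (0 : ℝ) < U := lt_trans hW0 hUlo
  have hU1 : 1 ≤ U := by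
    have : (0 : ℝ) < U := hU0
    have : 0 < U := by exact_mod_cast this
    omega
  have hxW : x / W = y * K := by rw [hW]; field_simp
  -- `x U⁻¹ (2U)^α ≤ 2 (yK)^{1-α} x^α`
  have hscale : x * (1 / (U : ℝ)) * (2 * (U : ℝ)) ^ α ≤ 2 * (((y : ℝ) * K) ^ (1 - α) * x ^ α) := by
    rw [Real.mul_rpow (by norm_num) hU0.le]
    have h2 : (2 : ℝ) ^ α ≤ 2 := by
      calc (2 : ℝ) ^ α ≤ 2 ^ (1 : ℝ) := Real.rpow_le_rpow_of_exponent_le (by norm_num) hα1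
        _ = 2 := Real.rpow_one 2
    have h3 : x * (1 / (U : ℝ)) * (U : ℝ) ^ α = x * (U : ℝ) ^ (α - 1) := by
      rw [Real.rpow_sub_one hU0.ne']; field_simp
    have h4 : (U : ℝ) ^ (α - 1) ≤ W ^ (α - 1) := Real.rpow_le_rpow_of_nonpos hW0 hUlo.le (by linarith)
    have h5 : x * W ^ (α - 1) = ((y : ℝ) * K) ^ (1 - α) * x ^ α := by
      rw [← hxW, Real.div_rpow hx0.le hW0.le, show (1 : ℝ) - α = -(α - 1) by ring, Real.rpow_neg hx0.le,
        Real.rpow_neg hW0.le, Real.rpow_sub_one hx0.ne']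
      field_simp
    calc x * (1 / (U : ℝ)) * ((2 : ℝ) ^ α * (U : ℝ) ^ α) = (2 : ℝ) ^ α * (x * (1 / (U : ℝ)) * (U : ℝ) ^ α) := by ring
      _ = (2 : ℝ) ^ α * (x * (U : ℝ) ^ (α - 1)) := by rw [h3]
      _ ≤ 2 * (x * W ^ (α - 1)) := by
          apply mul_le_mul h2 (mul_le_mul_of_nonneg_left h4 hx0.le) (by positivity) (by norm_num)
      _ = 2 * (((y : ℝ) * K) ^ (1 - α) * x ^ α) := by rw [h5]
  -- `N_U ≤ C₂ (2U)^α ζ̃`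
  have h2Ux : 2 * (U : ℝ) ≤ x := by
    calc 2 * (U : ℝ) ≤ 2 * (2 * x / K) := by linarith
      _ = 4 * x / K := by ring
      _ ≤ 4 * x / 16 := by gcongr
      _ ≤ x := by linarith
  have hNU : ((smoothBlock y U).card : ℝ) ≤ C₂ * ((2 * (U : ℝ)) ^ α * ζt) := by
    have hsub : smoothBlock y U ⊆ Nat.smoothNumbersUpTo ⌊2 * (U : ℝ)⌋₊ (y + 1) := by
      intro m hm
      rw [mem_smoothBlock] at hm
      rw [Nat.mem_smoothNumbersUpTo]
      refine ⟨?_, hm.2.2⟩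
      have : ⌊2 * (U : ℝ)⌋₊ = 2 * U := by exact_mod_cast Nat.floor_natCast (2 * U)
      rw [this]; omega
    have h1 := hM x y hx₀M hy4 hy6' (2 * U) (by linarith [show (1 : ℝ) ≤ U by exact_mod_cast hU1]) h2Ux
    rw [← hαdef] at h1
    calc ((smoothBlock y U).card : ℝ) ≤ (Nat.smoothNumbersUpTo ⌊2 * (U : ℝ)⌋₊ (y + 1)).card := by
          exact_mod_cast Finset.card_le_card hsub
      _ ≤ C₂ * ((2 * (U : ℝ)) ^ α * smoothZeta α y / Real.sqrt (saddlePhi₂ α y)) := h1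
      _ = C₂ * ((2 * (U : ℝ)) ^ α * ζt) := by rw [hζt]; ring
  ------------------------------------------------------------------
  -- the exponential sums over the block
  set Φ : ℝ := (a : ℝ) / q + η₀ with hΦ
  set B : ℝ := C * Real.log x ^ 3 * (y : ℝ) ^ (5 / 2 * (1 - α)) *
    ((q : ℝ) * (1 + |η₀| * W)) ^ e * ((2 * (U : ℝ)) ^ α * ζt) with hB
  have hB0 : 0 ≤ B := by positivity
  set CrT : ℝ := 100 * (1 + Real.log x) ^ 2 * (y : ℝ) ^ 2 * x ^ (4 / 5 : ℝ) with hCrT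
  have hCrT0 : 0 ≤ CrT := by
    have : 0 ≤ Real.log x := by rw [← hLx]; linarith
    positivity
  have hblock : ∀ d : ℤ, d ≠ 0 → |(d : ℝ)| ≤ 16 * K →
      ‖∑ m ∈ smoothBlock y U, (𝐞 ((d : ℝ) * ((m : ℝ) * Φ)) : ℂ)‖ ≤ 2 * (|(d : ℝ)| ^ (1 / 2 : ℝ) * B) + 2 * CrT := by
    intro d hd0 hd16
    have hWU : x / (y * K) - 1 ≤ ((U - 1 : ℕ) : ℝ) := by
      rw [Nat.cast_sub hU1]; push_cast; rw [← hW]; linarith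
    have hWU2 : x / (y * K) - 1 ≤ ((2 * U - 1 : ℕ) : ℝ) := by
      rw [Nat.cast_sub (by omega)]; push_cast; rw [← hW]; linarith
    have h24 : (2 : ℝ) * (2 * x / K) = 4 * x / K := by ring
    have h2xK : (0 : ℝ) ≤ 2 * x / K := by positivity
    have hU4 : ((U - 1 : ℕ) : ℝ) ≤ 4 * x / K := by
      rw [Nat.cast_sub hU1]; push_cast
      linarith
    have hU4' : ((2 * U - 1 : ℕ) : ℝ) ≤ 4 * x / K := by
      rw [Nat.cast_sub (by omega)]; push_cast; linarith
    have k1 := hD x y hx₀d hy8 hy6 hy200 K hK16 hK1000 q hq1 hqx a hcop η₀ hη₀ d hd0 hd16 _ hWU2 hU4'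
    have k2 := hD x y hx₀d hy8 hy6 hy200 K hK16 hK1000 q hq1 hqx a hcop η₀ hη₀ d hd0 hd16 _ hWU hU4
    rw [← hαdef, ← hΦ, ← hW, ← he, Nat.floor_natCast] at k1 k2
    -- the powers `X'^α ≤ (2U)^α`
    have hp1 : (((2 * U - 1 : ℕ) : ℝ)) ^ α ≤ (2 * (U : ℝ)) ^ α :=
      Real.rpow_le_rpow (Nat.cast_nonneg _) (by rw [Nat.cast_sub (by omega)]; push_cast; linarith) hα0.le
    have hp2 : (((U - 1 : ℕ) : ℝ)) ^ α ≤ (2 * (U : ℝ)) ^ α :=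
      Real.rpow_le_rpow (Nat.cast_nonneg _) (by rw [Nat.cast_sub hU1]; push_cast; linarith) hα0.le
    -- rewrite the phase `d (m Φ) = m (d Φ)`
    have hre : ∀ S : Finset ℕ, ∑ m ∈ S, (𝐞 ((d : ℝ) * ((m : ℝ) * Φ)) : ℂ) =
        ∑ m ∈ S, (𝐞 ((m : ℝ) * ((d : ℝ) * Φ)) : ℂ) := fun S =>
      Finset.sum_congr rfl fun m _ => by congr 2; ring
    rw [hre, sum_smoothBlock_eq_sub hU1]
    refine (norm_sub_le _ _).trans ?_
    have hK1 : ∀ X : ℝ, X ^ α ≤ (2 * (U : ℝ)) ^ α →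
        C * Real.log x ^ 3 * (y : ℝ) ^ (5 / 2 * (1 - α)) * |(d : ℝ)| ^ (1 / 2 : ℝ) *
          ((q : ℝ) * (1 + |η₀| * W)) ^ e * (X ^ α * (smoothZeta α y / Real.sqrt (saddlePhi₂ α y))) ≤
          |(d : ℝ)| ^ (1 / 2 : ℝ) * B := by
      intro X hX
      rw [hB, ← hζt]
      have : X ^ α * ζt ≤ (2 * (U : ℝ)) ^ α * ζt := mul_le_mul_of_nonneg_right hX hζt0
      calc C * Real.log x ^ 3 * (y : ℝ) ^ (5 / 2 * (1 - α)) * |(d : ℝ)| ^ (1 / 2 : ℝ) *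
            ((q : ℝ) * (1 + |η₀| * W)) ^ e * (X ^ α * ζt)
          ≤ C * Real.log x ^ 3 * (y : ℝ) ^ (5 / 2 * (1 - α)) * |(d : ℝ)| ^ (1 / 2 : ℝ) *
            ((q : ℝ) * (1 + |η₀| * W)) ^ e * ((2 * (U : ℝ)) ^ α * ζt) :=
            mul_le_mul_of_nonneg_left this (by positivity)
        _ = _ := by ring
    rw [← hCrT, ← hLx] at k1 k2
    have k1' := k1.trans (add_le_add (hK1 _ hp1) (le_refl CrT))
    have k2' := k2.trans (add_le_add (hK1 _ hp2) (le_refl CrT))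
    linarith
  ------------------------------------------------------------------
  -- sum over `d`
  set Dset := (Finset.Icc (-((16 * K : ℕ) : ℤ)) (16 * K : ℕ)).erase 0 with hDset
  have hDmem : ∀ d ∈ Dset, d ≠ 0 ∧ |(d : ℝ)| ≤ 16 * K ∧ 1 ≤ |(d : ℝ)| := by
    intro d hd
    rw [hDset, Finset.mem_erase, Finset.mem_Icc] at hd
    obtain ⟨hd0, h1, h2⟩ := hd
    refine ⟨hd0, ?_, ?_⟩
    · rw [abs_le]; push_cast at h1 h2 ⊢; constructor <;> [exact_mod_cast h1; exact_mod_cast h2]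
    · have : (1 : ℤ) ≤ |d| := Int.one_le_abs hd0
      have : ((1 : ℤ) : ℝ) ≤ ((|d| : ℤ) : ℝ) := by exact_mod_cast this
      push_cast at this; exact this
  have hDcard : (Dset.card : ℝ) ≤ 32 * K := by
    have h1 : Dset.card ≤ (Finset.Icc (-((16 * K : ℕ) : ℤ)) (16 * K : ℕ)).card := Finset.card_erase_le
    rw [Int.card_Icc] at h1
    have : ((16 * K : ℕ) : ℤ) + 1 - -((16 * K : ℕ) : ℤ) = 2 * (16 * K) + 1 := by push_cast; ring
    rw [this] at h1
    have h2 : Dset.card ≤ 32 * K + 1 := by omega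
    have h3 : 0 ∉ Dset := by rw [hDset]; exact Finset.notMem_erase 0 _
    -- sharper: `#Dset = 32K`; we only need `≤ 32K + 1 ≤ 33 K`… keep `≤ 32K` via the exact count
    have h4 : Dset.card = (Finset.Icc (-((16 * K : ℕ) : ℤ)) (16 * K : ℕ)).card - 1 :=
      Finset.card_erase_of_mem (by rw [Finset.mem_Icc]; constructor <;> push_cast <;> omega)
    rw [Int.card_Icc, this] at h4
    have : Dset.card = 32 * K := by omega
    rw [this]; push_cast; linarith
  have hsumd : ∑ d ∈ Dset, ‖∑ m ∈ smoothBlock y U, (𝐞 ((d : ℝ) * ((m : ℝ) * Φ)) : ℂ)‖ / |(d : ℝ)| ≤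
      32 * Real.sqrt K * B + 64 * K * CrT := by
    calc ∑ d ∈ Dset, ‖∑ m ∈ smoothBlock y U, (𝐞 ((d : ℝ) * ((m : ℝ) * Φ)) : ℂ)‖ / |(d : ℝ)|
        ≤ ∑ d ∈ Dset, (2 * B * |(d : ℝ)| ^ (-(1 / 2 : ℝ)) + 2 * CrT) := by
          refine Finset.sum_le_sum fun d hd => ?_
          obtain ⟨hd0, hd16, hd1⟩ := hDmem d hd
          have hdpos : 0 < |(d : ℝ)| := by linarith
          rw [div_le_iff₀ hdpos]
          refine (hblock d hd0 hd16).trans ?_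
          have h1 : |(d : ℝ)| ^ (-(1 / 2 : ℝ)) * |(d : ℝ)| = |(d : ℝ)| ^ (1 / 2 : ℝ) := by
            rw [show |(d : ℝ)| ^ (-(1 / 2 : ℝ)) * |(d : ℝ)| = |(d : ℝ)| ^ (-(1 / 2 : ℝ)) * |(d : ℝ)| ^ (1 : ℝ) by
              rw [Real.rpow_one], ← Real.rpow_add hdpos]; norm_num
          have h2 : 2 * CrT ≤ 2 * CrT * |(d : ℝ)| := le_mul_of_one_le_right (by positivity) hd1
          nlinarith [h1, h2, hB0, Real.rpow_nonneg hdpos.le (1 / 2 : ℝ)]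
      _ = 2 * B * ∑ d ∈ Dset, |(d : ℝ)| ^ (-(1 / 2 : ℝ)) + Dset.card * (2 * CrT) := by
          rw [Finset.sum_add_distrib, Finset.mul_sum, Finset.sum_const, nsmul_eq_mul]
      _ ≤ 2 * B * (4 * Real.sqrt ((16 * K : ℕ) : ℝ)) + (32 * K) * (2 * CrT) := by
          gcongr
          exact sum_Icc_erase_rpow_neg_half_le (16 * K)
      _ = 32 * Real.sqrt K * B + 64 * K * CrT := by
          have : Real.sqrt ((16 * K : ℕ) : ℝ) = 4 * Real.sqrt K := by
            push_cast
            rw [Real.sqrt_mul (by norm_num), show Real.sqrt (16 : ℝ) = 4 by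
              rw [show (16 : ℝ) = 4 ^ 2 by norm_num, Real.sqrt_sq (by norm_num)]]
          rw [this]; ring
  ------------------------------------------------------------------
  -- assemble
  have hxU0 : 0 ≤ x * (1 / (U : ℝ)) := by positivity
  calc x * (1 / (U : ℝ)) * (5 * (1 / (2 * Real.sqrt K)) * (smoothBlock y U).card +
        ∑ d ∈ Dset, ‖∑ m ∈ smoothBlock y U, (𝐞 ((d : ℝ) * ((m : ℝ) * Φ)) : ℂ)‖ / |(d : ℝ)|)
      ≤ x * (1 / (U : ℝ)) * (5 * (1 / (2 * Real.sqrt K)) * (C₂ * ((2 * (U : ℝ)) ^ α * ζt)) +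
          (32 * Real.sqrt K * B + 64 * K * CrT)) := by
        apply mul_le_mul_of_nonneg_left _ hxU0
        gcongr
    _ = (5 * C₂ / (2 * Real.sqrt K) * ζt +
          32 * Real.sqrt K * (C * Real.log x ^ 3 * (y : ℝ) ^ (5 / 2 * (1 - α)) *
            ((q : ℝ) * (1 + |η₀| * W)) ^ e * ζt)) * (x * (1 / (U : ℝ)) * (2 * (U : ℝ)) ^ α) +
          x * (1 / (U : ℝ)) * (64 * K * CrT) := by rw [hB]; ring
    _ ≤ (5 * C₂ / (2 * Real.sqrt K) * ζt +
          32 * Real.sqrt K * (C * Real.log x ^ 3 * (y : ℝ) ^ (5 / 2 * (1 - α)) *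
            ((q : ℝ) * (1 + |η₀| * W)) ^ e * ζt)) * (2 * (((y : ℝ) * K) ^ (1 - α) * x ^ α)) +
          (y * K) * (64 * K * CrT) := by
        apply add_le_add
        · exact mul_le_mul_of_nonneg_left hscale (by positivity)
        · apply mul_le_mul_of_nonneg_right _ (by positivity)
          -- `x / U ≤ x / W = yK`
          rw [← hxW]
          rw [show x * (1 / (U : ℝ)) = x / U by ring]
          exact div_le_div_of_nonneg_left hx0.le hW0 hUlo.le
    _ = (10 * C₂ * (1 / (2 * Real.sqrt K)) +
          64 * C * Real.sqrt K * Real.log x ^ 3 * (y : ℝ) ^ (5 / 2 * (1 - α)) *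
            ((q : ℝ) * (1 + |η₀| * W)) ^ e) * (((y : ℝ) * K) ^ (1 - α) * (x ^ α * ζt)) +
          64 * y * (K : ℝ) ^ 2 * CrT := by ring
    _ ≤ (10 * C₂ * (K : ℝ) ^ (-(1 / 2 : ℝ)) +
          64 * C * Real.sqrt K * Real.log x ^ 3 * (y : ℝ) ^ (5 / 2 * (1 - α)) *
            ((q : ℝ) * (1 + |η₀| * W)) ^ e) * (((y : ℝ) * K) ^ (1 - α) * (x ^ α * ζt)) +
          6400 * y * (K : ℝ) ^ 2 * ((1 + Real.log x) ^ 2 * (y : ℝ) ^ 2 * x ^ (4 / 5 : ℝ)) := by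
        have hinv : 1 / (2 * Real.sqrt K) ≤ (K : ℝ) ^ (-(1 / 2 : ℝ)) := by
          rw [Real.rpow_neg hK0.le, ← Real.sqrt_eq_rpow, inv_eq_one_div]
          exact one_div_le_one_div_of_le hsqK0 (by linarith [Real.sqrt_nonneg (K : ℝ)])
        have hfac : 0 ≤ ((y : ℝ) * K) ^ (1 - α) * (x ^ α * ζt) := by positivity
        have h1 : (10 * C₂ * (1 / (2 * Real.sqrt K)) +
            64 * C * Real.sqrt K * Real.log x ^ 3 * (y : ℝ) ^ (5 / 2 * (1 - α)) *
              ((q : ℝ) * (1 + |η₀| * W)) ^ e) ≤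
            (10 * C₂ * (K : ℝ) ^ (-(1 / 2 : ℝ)) +
            64 * C * Real.sqrt K * Real.log x ^ 3 * (y : ℝ) ^ (5 / 2 * (1 - α)) *
              ((q : ℝ) * (1 + |η₀| * W)) ^ e) := by
          have := mul_le_mul_of_nonneg_left hinv (show 0 ≤ 10 * C₂ by positivity)
          linarith
        have h2 : 64 * y * (K : ℝ) ^ 2 * CrT = 6400 * y * (K : ℝ) ^ 2 * ((1 + Real.log x) ^ 2 * (y : ℝ) ^ 2 * x ^ (4 / 5 : ℝ)) := by
          rw [hCrT]; ring
        rw [h2]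
        exact add_le_add (mul_le_mul_of_nonneg_right h1 hfac) le_rfl

set_option maxHeartbeats 8000000 in
-- long
/-- **Differences off the fairly-major arcs contribute little** (Harper §4, end of the proof of
Proposition 3, our thresholds). See the module docstring.
[cite: Harper2016, §4, proof of Proposition 3 (pp. 16–17)] -/
theorem sum_geomBound_prefix_le_of_not_major :
    ∃ C x₀ : ℝ, 0 < C ∧ ∀ (x : ℝ) (y : ℕ), x₀ ≤ x → Real.log x ^ 8 ≤ y →
      Real.log y ≤ 1 / 2 * Real.log x ^ (1 / 6 : ℝ) → (y : ℝ) ^ 200 ≤ x →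
      ∀ (K : ℕ), 16 ≤ K → (K : ℝ) ^ 1000 ≤ x → ∀ (Qs : ℝ), 1 ≤ Qs →
      ∀ t : ℝ, (∀ q : ℕ, 1 ≤ q → (q : ℝ) ≤ Qs → ∀ a : ℤ, Qs * y * K / (q * x) < |t - a / q|) →
        ∑ m ∈ prefixSet y (x / (y * K)), geomBound (x / m) ((m : ℝ) * t) ≤
          C * Real.log x ^ 4 * ((y : ℝ) * K) ^ (1 - saddlePoint x y) *
              (y : ℝ) ^ (5 / 2 * (1 - saddlePoint x y)) *
              ((K : ℝ) ^ (1 / 2 - saddlePoint x y) +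
                Real.sqrt K * Qs ^ (-(1 / 2 : ℝ) + 3 / 2 * (1 - saddlePoint x y))) *
            (x ^ saddlePoint x y *
              (smoothZeta (saddlePoint x y) y / Real.sqrt (saddlePhi₂ (saddlePoint x y) y))) +
          x ^ (19 / 20 : ℝ) := by
  classical
  obtain ⟨C, C₂c, x₀c, hC, hC₂c, hclass⟩ := nonmajor_class_bound
  obtain ⟨C₂, x₀M, hC₂, hM⟩ := card_smoothNumbersUpTo_le_model_of_le
  obtain ⟨x₀1, hlt1⟩ := saddlePoint_lt_one
  obtain ⟨x₀F, h1720⟩ := seventeen_twentieths_le_saddlePoint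
  refine ⟨C₂ + 30 * C₂c + 192 * C, max (max (max x₀c x₀M) (max x₀1 x₀F)) (Real.exp 1000), by positivity,
    fun x y hx hy8 hy6 hy200 K hK16 hK1000 Qs hQs t hnot => ?_⟩
  have hx₀c : x₀c ≤ x := le_trans (((le_max_left _ _).trans (le_max_left _ _)).trans (le_max_left _ _)) hx
  have hx₀M : x₀M ≤ x := le_trans (((le_max_right _ _).trans (le_max_left _ _)).trans (le_max_left _ _)) hx
  have hx₀1 : x₀1 ≤ x := le_trans (((le_max_left _ _).trans (le_max_right _ _)).trans (le_max_left _ _)) hx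
  have hx₀F : x₀F ≤ x := le_trans (((le_max_right _ _).trans (le_max_right _ _)).trans (le_max_left _ _)) hx
  have hxe : Real.exp 1000 ≤ x := le_trans (le_max_right _ _) hx
  have hK16r : (16 : ℝ) ≤ K := by exact_mod_cast hK16
  ------------------------------------------------------------------
  set Lx := Real.log x with hLx
  have hLx1000 : 1000 ≤ Lx := by
    have := Real.log_le_log (Real.exp_pos _) hxe; rwa [Real.log_exp] at this
  have hx1 : 1 < x := by
    have : (1 : ℝ) < Real.exp 1000 := by have := Real.add_one_le_exp (1000 : ℝ); linarith
    exact lt_of_lt_of_le this hxe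
  have hx0 : 0 < x := by linarith
  have hLx1 : 1 ≤ Lx := by linarith
  have hLx0 : 0 ≤ Lx := by linarith
  have hy4 : Lx ^ 4 ≤ y := le_trans (pow_le_pow_right₀ hLx1 (by norm_num)) hy8
  have hyL : Lx ≤ y := by
    calc Lx = Lx ^ 1 := (pow_one _).symm
      _ ≤ Lx ^ 8 := pow_le_pow_right₀ hLx1 (by norm_num)
      _ ≤ y := hy8
  have hy1 : (1 : ℝ) ≤ y := by linarith
  have hy0 : (0 : ℝ) < y := by linarith
  have hy2 : 2 ≤ y := by exact_mod_cast (show (2 : ℝ) ≤ y by linarith)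
  have hy6' : Real.log y ≤ Real.log x ^ (1 / 6 : ℝ) := by
    refine hy6.trans ?_
    have : 0 ≤ Lx ^ (1 / 6 : ℝ) := by positivity
    rw [hLx] at this ⊢; linarith
  have hlogy : Real.log y ≤ Lx := by
    refine hy6'.trans ?_
    calc Real.log x ^ (1 / 6 : ℝ) ≤ Real.log x ^ (1 : ℝ) := Real.rpow_le_rpow_of_exponent_le hLx1 (by norm_num)
      _ = Lx := by rw [Real.rpow_one]
  have hlogy0 : 0 ≤ Real.log y := Real.log_nonneg hy1
  have hyx : (y : ℝ) ≤ x := by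
    rw [← Real.exp_log hy0, ← Real.exp_log hx0]; exact Real.exp_le_exp.mpr hlogy
  have hK0 : (0 : ℝ) < K := by linarith
  have hK1 : (1 : ℝ) ≤ K := by linarith
  have hsqK0 : 0 < Real.sqrt K := Real.sqrt_pos.mpr hK0
  have hsqK2 : 2 ≤ Real.sqrt K := by
    rw [show (2 : ℝ) = Real.sqrt 4 by rw [show (4 : ℝ) = 2 ^ 2 by norm_num, Real.sqrt_sq (by norm_num)]]
    exact Real.sqrt_le_sqrt (by linarith)
  set α := saddlePoint x y with hαdef
  have hα0 : 0 < α := by rw [hαdef]; exact saddlePoint_pos hx1 hy2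
  have hα1 : α ≤ 1 := by
    have hy3 : Real.log x ^ 3 ≤ y := le_trans (pow_le_pow_right₀ hLx1 (by norm_num)) hy8
    exact (hlt1 x y hx₀1 hy3 hyx hy6').le
  have hα1720 : 17 / 20 ≤ α := h1720 x y hx₀F hy8 hyx
  set e : ℝ := -(1 / 2 : ℝ) + 3 / 2 * (1 - α) with he
  have he0 : e ≤ 0 := by rw [he]; linarith
  set ζt := smoothZeta α y / Real.sqrt (saddlePhi₂ α y) with hζt
  have hζt0 : 0 ≤ ζt := div_nonneg (smoothZeta_pos hα0).le (Real.sqrt_nonneg _)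
  set 𝓟 := x ^ α * ζt with h𝓟
  have h𝓟0 : 0 ≤ 𝓟 := by positivity
  -- `y ≤ x^{1/200}`, `K ≤ x^{1/1000}`
  have hyx200 : (y : ℝ) ≤ x ^ (1 / 200 : ℝ) := by
    have h : (x ^ (1 / 200 : ℝ)) ^ (200 : ℕ) = x := by
      rw [← Real.rpow_natCast, ← Real.rpow_mul hx0.le]; norm_num
    exact le_of_pow_le_pow_left₀ (by norm_num) (by positivity) (hy200.trans_eq h.symm)
  have hKx1000 : (K : ℝ) ≤ x ^ (1 / 1000 : ℝ) := by
    have h : (x ^ (1 / 1000 : ℝ)) ^ (1000 : ℕ) = x := by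
      rw [← Real.rpow_natCast, ← Real.rpow_mul hx0.le]; norm_num
    exact le_of_pow_le_pow_left₀ (by norm_num) (by positivity) (hK1000.trans_eq h.symm)
  ------------------------------------------------------------------
  -- `W = x/(yK)`
  set W := x / (y * K) with hW
  have hyK0 : (0 : ℝ) < y * K := by positivity
  have hW0 : 0 < W := by positivity
  have hWx : W ≤ x := by
    rw [hW]; exact div_le_self hx0.le (by nlinarith)
  have hW1 : 1 ≤ W := by
    -- `W ≥ x / (x^{1/200} x^{1/1000}) ≥ 1`
    rw [hW, le_div_iff₀ hyK0, one_mul]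
    calc (y : ℝ) * K ≤ x ^ (1 / 200 : ℝ) * x ^ (1 / 1000 : ℝ) := by gcongr
      _ = x ^ (6 / 1000 : ℝ) := by rw [← Real.rpow_add hx0]; norm_num
      _ ≤ x ^ (1 : ℝ) := Real.rpow_le_rpow_of_exponent_le hx1.le (by norm_num)
      _ = x := Real.rpow_one x
  have hxW : W * y = x / K := by rw [hW]; field_simp
  ------------------------------------------------------------------
  -- ### Dirichlet for `t` at level `x^{3/5}`
  set X5 := x ^ (3 / 5 : ℝ) with hX5
  have hX5_1 : 1 ≤ X5 := Real.one_le_rpow hx1.le (by norm_num)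
  obtain ⟨ρ, hρ, hρden⟩ := Real.exists_rat_abs_sub_le_and_den_le t (Nat.floor_pos.mpr hX5_1)
  set q : ℕ := ρ.den with hq
  set a : ℤ := ρ.num with ha
  have hq1 : 1 ≤ q := ρ.den_pos
  have hq0 : (0 : ℝ) < q := by exact_mod_cast hq1
  have hcop : IsCoprime a (q : ℤ) := by rw [ha, hq]; exact Rat.isCoprime_num_den ρ
  have hρeq : (ρ : ℝ) = (a : ℝ) / q := by rw [ha, hq]; exact_mod_cast (Rat.num_div_den ρ).symm
  set η₀ : ℝ := t - (a : ℝ) / q with hη₀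
  have ht : t = (a : ℝ) / q + η₀ := by rw [hη₀]; ring
  have hqX5 : (q : ℝ) ≤ X5 := le_trans (by exact_mod_cast hρden) (Nat.floor_le (by positivity))
  have hη₀b : |η₀| * q * X5 ≤ 1 := by
    have h1 : |η₀| ≤ 1 / ((⌊X5⌋₊ + 1) * q) := by rw [hη₀, ← hρeq]; exact hρ
    have h2 : X5 ≤ (⌊X5⌋₊ : ℝ) + 1 := (Nat.lt_floor_add_one X5).le
    rw [le_div_iff₀ (by positivity)] at h1
    calc |η₀| * q * X5 ≤ |η₀| * q * ((⌊X5⌋₊ : ℝ) + 1) := by gcongr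
      _ = |η₀| * ((⌊X5⌋₊ + 1) * q) := by ring
      _ ≤ 1 := h1
  -- not fairly major: `Qs ≤ q (1 + |η₀| W)`
  have hQsle : Qs ≤ q * (1 + |η₀| * W) := by
    rcases le_or_gt (q : ℝ) Qs with hqs | hqs
    · have h1 := hnot q hq1 hqs a
      rw [← hη₀] at h1
      rw [div_lt_iff₀ (by positivity)] at h1
      -- `Qs y K < |η₀| q x`, i.e. `Qs < q |η₀| W`
      have h2 : Qs < q * (|η₀| * W) := by
        rw [hW, show (q : ℝ) * (|η₀| * (x / (y * K))) = |η₀| * (q * x) / (y * K) by ring,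
          lt_div_iff₀ hyK0]
        linarith
      have h3 : 0 ≤ (q : ℝ) := hq0.le
      nlinarith [abs_nonneg η₀]
    · have : (q : ℝ) ≤ q * (1 + |η₀| * W) := le_mul_of_one_le_right hq0.le (by
        have : 0 ≤ |η₀| * W := by positivity
        linarith)
      linarith
  have hQs0 : 0 < Qs := by linarith
  have hpowQ : ((q : ℝ) * (1 + |η₀| * W)) ^ e ≤ Qs ^ e := Real.rpow_le_rpow_of_nonpos hQs0 hQsle he0
  ------------------------------------------------------------------
  -- ### apply the Erdős–Turán reduction
  set η : ℝ := 1 / (2 * Real.sqrt K) with hηdef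
  have hη0 : 0 < η := by positivity
  have hη4 : η ≤ 1 / 4 := by
    rw [hηdef]; exact one_div_le_one_div_of_le (by norm_num) (by linarith)
  have hη2 : η * η = 1 / (4 * K) := by
    rw [hηdef]
    have := Real.mul_self_sqrt hK0.le
    field_simp
    nlinarith [this]
  have hH : 2 ≤ (((16 * K : ℕ) : ℝ) + 1) * η ^ 2 := by
    rw [sq, hη2]; push_cast
    rw [mul_one_div, le_div_iff₀ (by positivity)]
    linarith
  rw [ht]
  have hpairs := sum_geomBound_prefix_le (x := x) (W := W) (η := η) (t := (a : ℝ) / q + η₀) (y := y)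
    (H := 16 * K) hW1 hWx hy2 hη0 hη4 hH
  refine hpairs.trans ?_
  ------------------------------------------------------------------
  -- ### T1: the cardinality term
  have hcard : ((prefixSet y W).card : ℝ) ≤ C₂ * ((x / K) ^ α * ζt) := by
    have hsub : prefixSet y W ⊆ Nat.smoothNumbersUpTo ⌊W * y⌋₊ (y + 1) := by
      intro m hm
      rw [mem_prefixSet hW0.le] at hm
      rw [Nat.mem_smoothNumbersUpTo]
      exact ⟨Nat.le_floor hm.2.1, hm.2.2.1⟩
    have h1 := hM x y hx₀M hy4 hy6' (W * y) (by nlinarith) (by rw [hxW]; exact div_le_self hx0.le hK1)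
    rw [← hαdef, hxW] at h1
    calc ((prefixSet y W).card : ℝ) ≤ (Nat.smoothNumbersUpTo ⌊x / K⌋₊ (y + 1)).card := by
          have := Finset.card_le_card hsub; rw [hxW] at this; exact_mod_cast this
      _ ≤ C₂ * ((x / K) ^ α * smoothZeta α y / Real.sqrt (saddlePhi₂ α y)) := h1
      _ = C₂ * ((x / K) ^ α * ζt) := by rw [hζt]; ring
  have hT1 : ((prefixSet y W).card : ℝ) / (2 * η) ≤ C₂ * (K : ℝ) ^ (1 / 2 - α) * 𝓟 := by
    have h2η : 1 / (2 * η) = Real.sqrt K := by rw [hηdef]; field_simp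
    rw [div_eq_mul_one_div, h2η]
    have hxK : (x / K) ^ α = x ^ α * (K : ℝ) ^ (-α) := by
      rw [Real.div_rpow hx0.le hK0.le, Real.rpow_neg hK0.le, div_eq_mul_inv]
    have hKpow : Real.sqrt K * (K : ℝ) ^ (-α) = (K : ℝ) ^ (1 / 2 - α) := by
      rw [Real.sqrt_eq_rpow, ← Real.rpow_add hK0]; ring_nf
    calc ((prefixSet y W).card : ℝ) * Real.sqrt K ≤ C₂ * ((x / K) ^ α * ζt) * Real.sqrt K :=
          mul_le_mul_of_nonneg_right hcard (Real.sqrt_nonneg _)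
      _ = C₂ * (Real.sqrt K * (K : ℝ) ^ (-α)) * (x ^ α * ζt) := by rw [hxK]; ring
      _ = C₂ * (K : ℝ) ^ (1 / 2 - α) * 𝓟 := by rw [hKpow, h𝓟]
  ------------------------------------------------------------------
  -- ### T2 + T3: the dyadic classes
  set J := Nat.log 2 y with hJ
  have hJ3 : ((J : ℕ) : ℝ) + 1 ≤ 3 * Lx := by
    have h1 : (2 : ℝ) ^ J ≤ y := by exact_mod_cast Nat.pow_log_le_self 2 (by omega)
    have h2 : (J : ℝ) * Real.log 2 ≤ Real.log y := by
      rw [← Real.log_pow]; exact Real.log_le_log (by positivity) h1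
    have hl2 : (1 : ℝ) / 2 < Real.log 2 := by have := Real.log_two_gt_d9; linarith
    nlinarith
  set AK : ℝ := 10 * C₂c * (K : ℝ) ^ (-(1 / 2 : ℝ)) +
    64 * C * Real.sqrt K * Real.log x ^ 3 * (y : ℝ) ^ (5 / 2 * (1 - α)) *
      ((q : ℝ) * (1 + |η₀| * W)) ^ e with hAK
  set CrS : ℝ := (1 + Real.log x) ^ 2 * (y : ℝ) ^ 2 * x ^ (4 / 5 : ℝ) with hCrS
  have hCrS0 : 0 ≤ CrS := by
    have : 0 ≤ Real.log x := by rw [← hLx]; exact hLx0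
    rw [hCrS]; positivity
  have hclassj : ∀ j ∈ Finset.range (J + 1),
      x * (1 / ((((⌊W⌋₊ + 1) * 2 ^ j : ℕ) : ℝ))) *
        (5 * η * (smoothBlock y ((⌊W⌋₊ + 1) * 2 ^ j)).card +
          ∑ d ∈ (Finset.Icc (-((16 * K : ℕ) : ℤ)) (16 * K : ℕ)).erase 0,
            ‖∑ m ∈ smoothBlock y ((⌊W⌋₊ + 1) * 2 ^ j), (𝐞 ((d : ℝ) * ((m : ℝ) * ((a : ℝ) / q + η₀))) : ℂ)‖ /
              |(d : ℝ)|) ≤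
        AK * (((y : ℝ) * K) ^ (1 - α) * 𝓟) + 6400 * y * (K : ℝ) ^ 2 * CrS := by
    intro j hj
    rw [Finset.mem_range, Nat.lt_succ_iff] at hj
    set U : ℕ := (⌊W⌋₊ + 1) * 2 ^ j with hU
    have hWU : W < U := by
      rw [hU]; push_cast
      have h1 : W < (⌊W⌋₊ : ℝ) + 1 := Nat.lt_floor_add_one W
      have h2 : (1 : ℝ) ≤ 2 ^ j := one_le_pow₀ (by norm_num)
      have h3 : 0 ≤ (⌊W⌋₊ : ℝ) + 1 := by positivity
      nlinarith
    have hUhi : (U : ℝ) ≤ 2 * x / K := by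
      rw [hU]; push_cast
      have h1 : (2 : ℝ) ^ j ≤ y := by
        calc (2 : ℝ) ^ j ≤ 2 ^ J := pow_le_pow_right₀ (by norm_num) hj
          _ ≤ y := by exact_mod_cast Nat.pow_log_le_self 2 (by omega)
      have h2 : (⌊W⌋₊ : ℝ) + 1 ≤ 2 * W := by linarith [Nat.floor_le hW0.le]
      calc ((⌊W⌋₊ : ℝ) + 1) * 2 ^ j ≤ (2 * W) * y := by gcongr
        _ = 2 * (W * y) := by ring
        _ = 2 * x / K := by rw [hxW]; ring
    have key := hclass x y hx₀c hy8 hy6 hy200 K hK16 hK1000 q hq1 (by rw [← hX5]; exact hqX5) a hcop η₀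
      (by rw [← hX5]; exact hη₀b) U hWU hUhi
    rw [← hαdef, ← hW, ← he, ← hζt, ← h𝓟, ← hAK, ← hCrS, ← hηdef] at key
    convert key using 2
  -- sum over `j`
  have hT23 : x * ∑ j ∈ Finset.range (J + 1),
      (1 / ((((⌊W⌋₊ + 1) * 2 ^ j : ℕ) : ℝ))) *
        (5 * η * (smoothBlock y ((⌊W⌋₊ + 1) * 2 ^ j)).card +
          ∑ d ∈ (Finset.Icc (-((16 * K : ℕ) : ℤ)) (16 * K : ℕ)).erase 0,
            ‖∑ m ∈ smoothBlock y ((⌊W⌋₊ + 1) * 2 ^ j), (𝐞 ((d : ℝ) * ((m : ℝ) * ((a : ℝ) / q + η₀))) : ℂ)‖ /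
              |(d : ℝ)|) ≤
      3 * Lx * (AK * (((y : ℝ) * K) ^ (1 - α) * 𝓟) + 6400 * y * (K : ℝ) ^ 2 * CrS) := by
    rw [Finset.mul_sum]
    calc ∑ j ∈ Finset.range (J + 1), x * ((1 / ((((⌊W⌋₊ + 1) * 2 ^ j : ℕ) : ℝ))) *
          (5 * η * (smoothBlock y ((⌊W⌋₊ + 1) * 2 ^ j)).card +
            ∑ d ∈ (Finset.Icc (-((16 * K : ℕ) : ℤ)) (16 * K : ℕ)).erase 0,
              ‖∑ m ∈ smoothBlock y ((⌊W⌋₊ + 1) * 2 ^ j), (𝐞 ((d : ℝ) * ((m : ℝ) * ((a : ℝ) / q + η₀))) : ℂ)‖ /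
                |(d : ℝ)|))
        ≤ ∑ j ∈ Finset.range (J + 1), (AK * (((y : ℝ) * K) ^ (1 - α) * 𝓟) + 6400 * y * (K : ℝ) ^ 2 * CrS) := by
          refine Finset.sum_le_sum fun j hj => ?_
          rw [← mul_assoc]; exact hclassj j hj
      _ = ((J : ℝ) + 1) * (AK * (((y : ℝ) * K) ^ (1 - α) * 𝓟) + 6400 * y * (K : ℝ) ^ 2 * CrS) := by
          rw [Finset.sum_const, Finset.card_range, nsmul_eq_mul]; push_cast; ring
      _ ≤ 3 * Lx * (AK * (((y : ℝ) * K) ^ (1 - α) * 𝓟) + 6400 * y * (K : ℝ) ^ 2 * CrS) := by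
          apply mul_le_mul_of_nonneg_right hJ3
          have hAK0 : 0 ≤ AK := by positivity
          positivity
  ------------------------------------------------------------------
  -- ### final algebra
  have hAKle : AK ≤ (10 * C₂c + 64 * C * Real.log x ^ 3 * (y : ℝ) ^ (5 / 2 * (1 - α))) *
      ((K : ℝ) ^ (1 / 2 - α) + Real.sqrt K * Qs ^ e) := by
    have h1 : (K : ℝ) ^ (-(1 / 2 : ℝ)) ≤ (K : ℝ) ^ (1 / 2 - α) :=
      Real.rpow_le_rpow_of_exponent_le hK1 (by linarith)
    have h2 : Real.sqrt K * Real.log x ^ 3 * (y : ℝ) ^ (5 / 2 * (1 - α)) * ((q : ℝ) * (1 + |η₀| * W)) ^ e ≤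
        Real.log x ^ 3 * (y : ℝ) ^ (5 / 2 * (1 - α)) * (Real.sqrt K * Qs ^ e) := by
      have : 0 ≤ Real.sqrt K * Real.log x ^ 3 * (y : ℝ) ^ (5 / 2 * (1 - α)) := by
        have : 0 ≤ Real.log x := by rw [← hLx]; exact hLx0
        positivity
      calc Real.sqrt K * Real.log x ^ 3 * (y : ℝ) ^ (5 / 2 * (1 - α)) * ((q : ℝ) * (1 + |η₀| * W)) ^ e
          ≤ Real.sqrt K * Real.log x ^ 3 * (y : ℝ) ^ (5 / 2 * (1 - α)) * Qs ^ e :=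
            mul_le_mul_of_nonneg_left hpowQ this
        _ = _ := by ring
    have hpos1 : 0 ≤ (K : ℝ) ^ (1 / 2 - α) := by positivity
    have hpos2 : 0 ≤ Real.sqrt K * Qs ^ e := by positivity
    have hpos3 : 0 ≤ Real.log x ^ 3 * (y : ℝ) ^ (5 / 2 * (1 - α)) := by
      have : 0 ≤ Real.log x := by rw [← hLx]; exact hLx0
      positivity
    rw [hAK]
    nlinarith [mul_nonneg hC₂c.le hpos2, mul_nonneg (mul_nonneg hC.le hpos3) hpos1]
  have hleft : Lx ^ 4 * ((y : ℝ) * K) ^ (1 - α) * (y : ℝ) ^ (5 / 2 * (1 - α)) ≥ 1 := by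
    have h1 : (1 : ℝ) ≤ Lx ^ 4 := one_le_pow₀ hLx1
    have h2 : (1 : ℝ) ≤ ((y : ℝ) * K) ^ (1 - α) := Real.one_le_rpow (by nlinarith) (by linarith)
    have h3 : (1 : ℝ) ≤ (y : ℝ) ^ (5 / 2 * (1 - α)) := Real.one_le_rpow hy1 (by nlinarith)
    have := one_le_mul_of_one_le_of_one_le (one_le_mul_of_one_le_of_one_le h1 h2) h3
    linarith
  have hleftover : 3 * Lx * (6400 * y * (K : ℝ) ^ 2 * CrS) ≤ x ^ (19 / 20 : ℝ) := by
    have := nonmajor_leftover_aux (y := y) (K := K) hxe hy1 hK1 hyx200 hKx1000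
    rw [← hLx] at this
    rw [hCrS, ← hLx]
    nlinarith [this]
  -- combine
  set Main : ℝ := Lx ^ 4 * ((y : ℝ) * K) ^ (1 - α) * (y : ℝ) ^ (5 / 2 * (1 - α)) *
    ((K : ℝ) ^ (1 / 2 - α) + Real.sqrt K * Qs ^ e) * 𝓟 with hMain
  have hMain0 : 0 ≤ Main := by positivity
  have hpiece1 : C₂ * (K : ℝ) ^ (1 / 2 - α) * 𝓟 ≤ C₂ * Main := by
    rw [hMain]
    have h1 : (K : ℝ) ^ (1 / 2 - α) ≤ (K : ℝ) ^ (1 / 2 - α) + Real.sqrt K * Qs ^ e :=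
      le_add_of_nonneg_right (by positivity)
    have h2 : (K : ℝ) ^ (1 / 2 - α) * 𝓟 ≤ (Lx ^ 4 * ((y : ℝ) * K) ^ (1 - α) * (y : ℝ) ^ (5 / 2 * (1 - α))) *
        (((K : ℝ) ^ (1 / 2 - α) + Real.sqrt K * Qs ^ e) * 𝓟) := by
      calc (K : ℝ) ^ (1 / 2 - α) * 𝓟 ≤ ((K : ℝ) ^ (1 / 2 - α) + Real.sqrt K * Qs ^ e) * 𝓟 :=
            mul_le_mul_of_nonneg_right h1 h𝓟0
        _ = 1 * (((K : ℝ) ^ (1 / 2 - α) + Real.sqrt K * Qs ^ e) * 𝓟) := (one_mul _).symm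
        _ ≤ _ := mul_le_mul_of_nonneg_right hleft (by positivity)
    calc C₂ * (K : ℝ) ^ (1 / 2 - α) * 𝓟 = C₂ * ((K : ℝ) ^ (1 / 2 - α) * 𝓟) := by ring
      _ ≤ C₂ * ((Lx ^ 4 * ((y : ℝ) * K) ^ (1 - α) * (y : ℝ) ^ (5 / 2 * (1 - α))) *
          (((K : ℝ) ^ (1 / 2 - α) + Real.sqrt K * Qs ^ e) * 𝓟)) := mul_le_mul_of_nonneg_left h2 hC₂.le
      _ = _ := by ring
  have hpiece2 : 3 * Lx * (AK * (((y : ℝ) * K) ^ (1 - α) * 𝓟)) ≤ (30 * C₂c + 192 * C) * Main := by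
    have h1 : AK * (((y : ℝ) * K) ^ (1 - α) * 𝓟) ≤
        (10 * C₂c + 64 * C * Real.log x ^ 3 * (y : ℝ) ^ (5 / 2 * (1 - α))) *
          ((K : ℝ) ^ (1 / 2 - α) + Real.sqrt K * Qs ^ e) * (((y : ℝ) * K) ^ (1 - α) * 𝓟) :=
      mul_le_mul_of_nonneg_right hAKle (by positivity)
    -- `3 Lx (10 C₂c + 64 C Lx³ y^…) ≤ (30 C₂c + 192 C) Lx⁴ y^…`
    have h2 : 3 * Lx * (10 * C₂c + 64 * C * Real.log x ^ 3 * (y : ℝ) ^ (5 / 2 * (1 - α))) ≤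
        (30 * C₂c + 192 * C) * (Lx ^ 4 * (y : ℝ) ^ (5 / 2 * (1 - α))) := by
      rw [← hLx]
      have hy5 : (1 : ℝ) ≤ (y : ℝ) ^ (5 / 2 * (1 - α)) := Real.one_le_rpow hy1 (by nlinarith)
      have hL4 : Lx ≤ Lx ^ 4 := by
        calc Lx = Lx ^ 1 := (pow_one _).symm
          _ ≤ Lx ^ 4 := pow_le_pow_right₀ hLx1 (by norm_num)
      have hL3 : Lx * Lx ^ 3 = Lx ^ 4 := by ring
      have hA : 3 * Lx * (10 * C₂c) ≤ 30 * C₂c * (Lx ^ 4 * (y : ℝ) ^ (5 / 2 * (1 - α))) := by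
        have : Lx ≤ Lx ^ 4 * (y : ℝ) ^ (5 / 2 * (1 - α)) := by
          calc Lx ≤ Lx ^ 4 := hL4
            _ = Lx ^ 4 * 1 := (mul_one _).symm
            _ ≤ Lx ^ 4 * (y : ℝ) ^ (5 / 2 * (1 - α)) := by gcongr
        nlinarith [hC₂c.le]
      have hB : 3 * Lx * (64 * C * Lx ^ 3 * (y : ℝ) ^ (5 / 2 * (1 - α))) =
          192 * C * (Lx ^ 4 * (y : ℝ) ^ (5 / 2 * (1 - α))) := by ring
      nlinarith [hA, hB]
    calc 3 * Lx * (AK * (((y : ℝ) * K) ^ (1 - α) * 𝓟))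
        ≤ 3 * Lx * ((10 * C₂c + 64 * C * Real.log x ^ 3 * (y : ℝ) ^ (5 / 2 * (1 - α))) *
            ((K : ℝ) ^ (1 / 2 - α) + Real.sqrt K * Qs ^ e) * (((y : ℝ) * K) ^ (1 - α) * 𝓟)) :=
          mul_le_mul_of_nonneg_left h1 (by positivity)
      _ = (3 * Lx * (10 * C₂c + 64 * C * Real.log x ^ 3 * (y : ℝ) ^ (5 / 2 * (1 - α)))) *
            (((K : ℝ) ^ (1 / 2 - α) + Real.sqrt K * Qs ^ e) * (((y : ℝ) * K) ^ (1 - α) * 𝓟)) := by ring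
      _ ≤ ((30 * C₂c + 192 * C) * (Lx ^ 4 * (y : ℝ) ^ (5 / 2 * (1 - α)))) *
            (((K : ℝ) ^ (1 / 2 - α) + Real.sqrt K * Qs ^ e) * (((y : ℝ) * K) ^ (1 - α) * 𝓟)) :=
          mul_le_mul_of_nonneg_right h2 (by positivity)
      _ = (30 * C₂c + 192 * C) * Main := by rw [hMain]; ring
  calc (prefixSet y W).card / (2 * η) +
        x * ∑ j ∈ Finset.range (J + 1), (1 / ((((⌊W⌋₊ + 1) * 2 ^ j : ℕ) : ℝ))) *
          (5 * η * (smoothBlock y ((⌊W⌋₊ + 1) * 2 ^ j)).card +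
            ∑ d ∈ (Finset.Icc (-((16 * K : ℕ) : ℤ)) (16 * K : ℕ)).erase 0,
              ‖∑ m ∈ smoothBlock y ((⌊W⌋₊ + 1) * 2 ^ j), (𝐞 ((d : ℝ) * ((m : ℝ) * ((a : ℝ) / q + η₀))) : ℂ)‖ /
                |(d : ℝ)|)
      ≤ C₂ * (K : ℝ) ^ (1 / 2 - α) * 𝓟 +
          3 * Lx * (AK * (((y : ℝ) * K) ^ (1 - α) * 𝓟) + 6400 * y * (K : ℝ) ^ 2 * CrS) := add_le_add hT1 hT23
    _ = C₂ * (K : ℝ) ^ (1 / 2 - α) * 𝓟 + 3 * Lx * (AK * (((y : ℝ) * K) ^ (1 - α) * 𝓟)) +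
          3 * Lx * (6400 * y * (K : ℝ) ^ 2 * CrS) := by ring
    _ ≤ C₂ * Main + (30 * C₂c + 192 * C) * Main + x ^ (19 / 20 : ℝ) :=
        add_le_add (add_le_add hpiece1 hpiece2) hleftover
    _ = (C₂ + 30 * C₂c + 192 * C) * Lx ^ 4 * ((y : ℝ) * K) ^ (1 - α) * (y : ℝ) ^ (5 / 2 * (1 - α)) *
          ((K : ℝ) ^ (1 / 2 - α) + Real.sqrt K * Qs ^ e) * 𝓟 + x ^ (19 / 20 : ℝ) := by rw [hMain]; ring
    _ = _ := by rw [h𝓟, he, hζt]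

end Literature.NumberTheory.Sieve

end
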